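import Literature.NumberTheory.QuadraticFields.ScholzHeckeUnitCriterionProofs
import Mathlib.NumberTheory.Pell
import HarnessLib

/-!
# The Scholz–Hecke unit criterion — the arithmetic spelling recovered from `ε⁸ ≡ 1 (mod λ³)`

Topic `NumberTheory/QuadraticFields`.  Theorem-only continuation of
`ScholzHeckeUnitCriterionProofs.lean` towards direction (ii) of `ScholzHecke_unitCubeCriterion`:

* `exists_isMirrorFundUnit` — the witness `(a, b)` of `IsMirrorFundUnit d a b` EXISTS for every
  fundamental `−d`, `d ≠ 3` (Pell's equation, Mathlib's `Pell.exists_of_not_isSquare`, and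
  well-ordering of `ℕ` for the least `a`);
* `unitCubeAtThree_of_pow_eight_sub_one_eq` — the converse of the unwinding
  `ScholzHecke.exists_ringOfIntegers_unit_data`: in a number field `M ∋ λ, δ` (`λ² = −3`, `δ² = −d`)
  with a ring endomorphism `τ` fixing `δ` and negating `λ` (the conjugation of `M = K(λ)` over
  `K = ℚ(δ)`), if `ε⁸ − 1 = λ³w` with `w` integral, for `ε = (a + b√d₀)/2`, `√d₀ = δλ/c₀`, then the
  congruences of `UnitCubeAtThree d` hold: with `(a + b√d₀)⁸ = X + Y√d₀` one gets
  `(X − 256) + Y√d₀ = 256λ³w`, so `2(X − 256)/λ³ = 256(w − τw)` and `2Y√d₀/λ³ = 256(w + τw)` are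
  algebraic integers whose squares `−4(X − 256)²/27`, `−4Y²d₀/27` are rational, hence integers:
  `9 ∣ X − 256` (`X ≡ 4 (mod 9)`) and `27 ∣ 4Y²d₀`, i.e. `9 ∣ Y` if `3 ∤ d₀` (`⟺ 3 ∣ d`) and `3 ∣ Y`
  if `3 ∥ d₀`.

This is the translation announced in the docstring of `ScholzHeckeUnitCriterion.lean` ("multiplying
by the unit `2⁸ ≡ 4 (mod 9)` …"), carried out inside `𝓞_M`.

## References

* E. Hecke, *Lectures on the Theory of Algebraic Numbers*, GTM 77 (1981), §39 Thm. 119. [Hecke1981]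
* M. J. Jacobson, H. C. Williams, *Solving the Pell Equation* (2008), Ch. 12. [JacobsonWilliams2008]
-/

noncomputable section

open Module NumberField Polynomial

namespace Literature.NumberTheory.QuadraticFields

namespace ScholzHecke

/-! ### Existence of the mirror fundamental unit -/

section Fundamental

variable {d : ℕ}
  (hd : ((-(d:ℤ)) % 4 = 1 ∧ Squarefree (-(d:ℤ)) ∧ (-(d:ℤ)) ≠ 1) ∨
      (4 ∣ (-(d:ℤ)) ∧ ((-(d:ℤ)) / 4 % 4 = 2 ∨ (-(d:ℤ)) / 4 % 4 = 3) ∧ Squarefree ((-(d:ℤ)) / 4)))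
include hd

/-- `d₀` is not a square (it is squarefree and `≠ 1`). [folklore] -/
theorem not_isSquare_mirrorRadicand (h3 : d ≠ 3) : ¬ IsSquare (mirrorRadicand d : ℤ) := by
  rintro ⟨m, hm⟩
  have hsq := squarefree_mirrorRadicand hd
  have h1 := mirrorRadicand_ne_one hd h3
  have hm' : (mirrorRadicand d : ℤ) = ((m.natAbs * m.natAbs : ℕ) : ℤ) := by
    rw [hm, Nat.cast_mul, Int.natAbs_mul_self']
  have hmn : mirrorRadicand d = m.natAbs * m.natAbs := by exact_mod_cast hm'
  rw [hmn] at hsq h1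
  have hu : IsUnit m.natAbs := hsq m.natAbs ⟨1, by ring⟩
  rw [Nat.isUnit_iff] at hu
  rw [hu] at h1
  exact h1 rfl

/-- `9 ∤ d`, so `3 ∤ d₀` when `3 ∣ d`. [folklore] -/
theorem not_three_dvd_mirrorRadicand (h3d : 3 ∣ d) : ¬ 3 ∣ mirrorRadicand d := by
  intro h
  unfold mirrorRadicand at h
  rw [if_pos h3d] at h
  have h9 : 9 ∣ d := by
    split_ifs at h with h4
    · have h12 : 12 ∣ d := Nat.Coprime.mul_dvd_of_dvd_of_dvd (by norm_num) h3d h4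
      obtain ⟨k, rfl⟩ := h12
      rw [Nat.mul_div_cancel_left k (by norm_num)] at h
      obtain ⟨j, rfl⟩ := h
      exact ⟨4 * j, by ring⟩
    · obtain ⟨k, rfl⟩ := h3d
      rw [Nat.mul_div_cancel_left k (by norm_num)] at h
      obtain ⟨j, rfl⟩ := h
      exact ⟨j, by ring⟩
  rcases squarefree_or_four_dvd hd with ⟨hsq, _⟩ | ⟨h4, hsq, _⟩
  · exact absurd (hsq 3 h9) (by norm_num)
  · have : 9 ∣ d / 4 := by
      have h36 : 36 ∣ d := Nat.Coprime.mul_dvd_of_dvd_of_dvd (by norm_num) h9 h4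
      obtain ⟨k, rfl⟩ := h36
      rw [show 36 * k = 4 * (9 * k) by ring, Nat.mul_div_cancel_left _ (by norm_num)]
      exact dvd_mul_right 9 k
    exact absurd (hsq 3 this) (by norm_num)

/-- `9 ∤ d₀`: when `3 ∣ d₀`, `3 ∤ d₀/3`. [folklore] -/
theorem not_three_dvd_of_mirrorRadicand_eq {d₁ : ℕ} (h : mirrorRadicand d = 3 * d₁) : ¬ 3 ∣ d₁ := by
  rintro ⟨k, rfl⟩
  have hsq := squarefree_mirrorRadicand hd
  rw [h] at hsq
  exact absurd (hsq 3 ⟨k, by ring⟩) (by norm_num)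

/-- **The mirror fundamental unit exists**: some `(a, b)` satisfies `IsMirrorFundUnit d a b` (a
solution of `a² − d₀b² = ±4` with `b > 0` exists by Pell's equation, and `a` may be taken least).
[cite: JacobsonWilliams2008, Ch. 12] -/
theorem exists_isMirrorFundUnit (h3 : d ≠ 3) : ∃ a b : ℕ, IsMirrorFundUnit d a b := by
  classical
  have hd₀pos : (0 : ℤ) < mirrorRadicand d := by
    exact_mod_cast Nat.pos_of_ne_zero (mirrorRadicand_ne_zero hd)
  obtain ⟨x, y, hxy, hy⟩ := Pell.exists_of_not_isSquare hd₀pos (not_isSquare_mirrorRadicand hd h3)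
  -- the set of admissible `a` is nonempty
  let P : ℕ → Prop := fun a => ∃ b : ℕ, 0 < b ∧
    ((a:ℤ) ^ 2 - (mirrorRadicand d : ℤ) * (b:ℤ) ^ 2 = 4 ∨
      (a:ℤ) ^ 2 - (mirrorRadicand d : ℤ) * (b:ℤ) ^ 2 = -4)
  have hP : ∃ a, P a := ⟨(2 * x).natAbs, (2 * y).natAbs,
    Int.natAbs_pos.mpr (mul_ne_zero two_ne_zero hy), Or.inl (by
      push_cast
      rw [sq_abs, sq_abs]
      linear_combination 4 * hxy)⟩
  refine ⟨Nat.find hP, ?_⟩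
  obtain ⟨b, hb, hab⟩ := Nat.find_spec hP
  exact ⟨b, hb, hab, fun a' b' hb' hab' => Nat.find_min' hP ⟨b', hb', hab'⟩⟩

end Fundamental

/-! ### Integer and integrality lemmas -/

/-- `3 ∣ 4B²m` with `3 ∤ m` forces `3 ∣ B`. [folklore] -/
theorem three_dvd_of_dvd_four_mul_sq_mul {B m : ℤ} (hm : ¬ (3 : ℤ) ∣ m)
    (h : (3 : ℤ) ∣ 4 * B ^ 2 * m) : 3 ∣ B := by
  rcases (Int.prime_three.dvd_mul).mp h with h' | h'
  · rcases (Int.prime_three.dvd_mul).mp h' with h'' | h''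
    · norm_num at h''
    · exact Int.prime_three.dvd_of_dvd_pow h''
  · exact absurd h' hm

/-- `9 ∣ 4B²m` with `3 ∤ m` forces `3 ∣ B`. [folklore] -/
theorem three_dvd_of_nine_dvd {B m : ℤ} (hm : ¬ (3 : ℤ) ∣ m) (h : (9 : ℤ) ∣ 4 * B ^ 2 * m) :
    3 ∣ B :=
  three_dvd_of_dvd_four_mul_sq_mul hm ((show (3:ℤ) ∣ 9 by norm_num).trans h)

/-- `27 ∣ 4B²m` with `3 ∤ m` forces `9 ∣ B`. [folklore] -/
theorem nine_dvd_of_twentyseven_dvd {B m : ℤ} (hm : ¬ (3 : ℤ) ∣ m)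
    (h : (27 : ℤ) ∣ 4 * B ^ 2 * m) : 9 ∣ B := by
  obtain ⟨B', rfl⟩ := three_dvd_of_dvd_four_mul_sq_mul hm ((show (3:ℤ) ∣ 27 by norm_num).trans h)
  have h' : (9 : ℤ) * 3 ∣ 9 * (4 * B' ^ 2 * m) := by
    rw [show (9 : ℤ) * (4 * B' ^ 2 * m) = 4 * (3 * B') ^ 2 * m by ring]
    exact (show (9 : ℤ) * 3 = 27 by norm_num) ▸ h
  obtain ⟨B'', rfl⟩ :=
    three_dvd_of_dvd_four_mul_sq_mul hm ((mul_dvd_mul_iff_left (by norm_num)).mp h')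
  exact ⟨B'', by ring⟩

/-- A rational algebraic integer (seen in a field of characteristic `0`) is an integer. [folklore] -/
theorem exists_int_of_isIntegral_ratCast {M : Type*} [Field M] [CharZero M] {r : ℚ}
    (h : IsIntegral ℤ (r : M)) : ∃ z : ℤ, (z : ℚ) = r := by
  have h' : IsIntegral ℤ r := by
    rw [← isIntegral_algebraMap_iff (B := M) (algebraMap ℚ M).injective, eq_ratCast]
    exact h
  obtain ⟨z, hz⟩ := IsIntegrallyClosed.algebraMap_eq_of_integral h'
  exact ⟨z, by simpa using hz⟩

/-- `256 ε⁸ = X + Y√d₀` for `2ε = a + b√d₀`, `(a + b√d₀)⁸ = X + Y√d₀` computed in `ℤ[√d₀]`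
(`unitPow8`, via `Zsqrtd.lift`). [folklore] -/
theorem two_pow_eight_mul_pow_eight {M : Type*} [CommRing M] {sM εM : M} {d a b : ℕ}
    (hss : sM * sM = ((mirrorRadicand d : ℤ) : M)) (h2ε : 2 * εM = a + b * sM) :
    (256 : M) * εM ^ 8 = (unitPow8 d a b).re + (unitPow8 d a b).im * sM := by
  have h1 : Zsqrtd.lift ⟨sM, hss⟩ (⟨a, b⟩ : ℤ√(mirrorRadicand d : ℤ)) = a + b * sM := by
    rw [Zsqrtd.lift_apply_apply]; push_cast; rfl
  have h2 := Zsqrtd.lift_apply_apply ⟨sM, hss⟩ ((⟨a, b⟩ : ℤ√(mirrorRadicand d : ℤ)) ^ 8)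
  rw [map_pow, h1, ← h2ε] at h2
  show (256 : M) * εM ^ 8 =
    ((((⟨a, b⟩ : ℤ√(mirrorRadicand d : ℤ)) ^ 8).re : ℤ) : M) +
      ((((⟨a, b⟩ : ℤ√(mirrorRadicand d : ℤ)) ^ 8).im : ℤ) : M) * sM
  linear_combination h2

/-! ### From `ε⁸ ≡ 1 (mod λ³)` to the congruences of `UnitCubeAtThree` -/

/-- **The congruences of `UnitCubeAtThree d` from `ε⁸ − 1 ∈ λ³𝓞_M`** (see the module docstring).
Here `M` is any number field containing `λ` (`λ² = −3`) and `δ` (`δ² = −d`), `τ` a ring endomorphism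
of `M` with `τλ = −λ`, `τδ = δ`, `(a, b)` the witness of `IsMirrorFundUnit d a b`, `3d = d₀c₀²`, and
`ε = a/2 + (b/2c₀)δλ = (a + b√d₀)/2`. [cite: Hecke1981, §39 Thm. 119] -/
theorem unitCubeAtThree_of_pow_eight_sub_one_eq {M : Type*} [Field M] [NumberField M]
    {lamM δM : M} (hlam : lamM ^ 2 = -3) {d : ℕ} (hδ : δM ^ 2 = -(d : M))
    (τ : M →+* M) (hτl : τ lamM = -lamM) (hτδ : τ δM = δM)
    (hd : ((-(d:ℤ)) % 4 = 1 ∧ Squarefree (-(d:ℤ)) ∧ (-(d:ℤ)) ≠ 1) ∨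
      (4 ∣ (-(d:ℤ)) ∧ ((-(d:ℤ)) / 4 % 4 = 2 ∨ (-(d:ℤ)) / 4 % 4 = 3) ∧ Squarefree ((-(d:ℤ)) / 4)))
    {a b c₀ : ℕ} (hunit : IsMirrorFundUnit d a b) (hc₀0 : c₀ ≠ 0)
    (hc₀ : 3 * d = mirrorRadicand d * c₀ ^ 2) {w : M} (hw : IsIntegral ℤ w)
    (h : ((a : M) / 2 + (b : M) / (2 * c₀) * δM * lamM) ^ 8 - 1 = lamM ^ 3 * w) :
    UnitCubeAtThree d := by
  set d₀ := mirrorRadicand d with hd₀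
  have hc₀M : (c₀ : M) ≠ 0 := Nat.cast_ne_zero.mpr hc₀0
  have hl0 : lamM ≠ 0 := by rintro rfl; norm_num at hlam
  have hl3 : lamM ^ 3 ≠ 0 := pow_ne_zero 3 hl0
  have hl6 : (lamM ^ 3) ^ 2 = -27 := by linear_combination (lamM ^ 4 - 3 * lamM ^ 2 + 9) * hlam
  have h3d : (3 * d : M) = d₀ * (c₀ : M) ^ 2 := by exact_mod_cast hc₀
  -- `s = δλ/c₀`, `s² = d₀`, `τ s = −s`; `2ε = a + bs`
  set sM : M := δM * lamM / c₀ with hsM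
  have hs2 : sM ^ 2 = d₀ := by
    rw [hsM, div_pow, mul_pow, hδ, hlam, div_eq_iff (pow_ne_zero 2 hc₀M)]
    linear_combination h3d
  have hss : sM * sM = ((d₀ : ℤ) : M) := by rw [← sq, hs2, Int.cast_natCast]
  have hτs : τ sM = -sM := by rw [hsM, map_div₀, map_mul, map_natCast, hτl, hτδ]; ring
  set εM : M := (a : M) / 2 + (b : M) / (2 * c₀) * δM * lamM with hεM
  have h2ε : 2 * εM = a + b * sM := by rw [hεM, hsM]; field_simp
  have h256 := two_pow_eight_mul_pow_eight hss h2ε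
  set X : ℤ := (unitPow8 d a b).re with hX
  set Y : ℤ := (unitPow8 d a b).im with hY
  -- `(X − 256) + Y s = 256 λ³ w`, and its `τ`-conjugate
  have key : ((X : M) - 256) + (Y : M) * sM = lamM ^ 3 * (256 * w) := by
    linear_combination -h256 + 256 * h
  have key' : ((X : M) - 256) - (Y : M) * sM = -(lamM ^ 3 * (256 * τ w)) := by
    have := congrArg τ key
    simp only [map_add, map_sub, map_mul, map_pow, map_intCast, map_ofNat, hτs, hτl] at this
    linear_combination this
  have hA : ((2 * (X - 256) : ℤ) : M) / lamM ^ 3 = 256 * w - 256 * τ w := by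
    rw [div_eq_iff hl3]; push_cast; linear_combination key + key'
  have hB : ((2 * Y : ℤ) : M) * sM / lamM ^ 3 = 256 * w + 256 * τ w := by
    rw [div_eq_iff hl3]; push_cast; linear_combination key - key'
  -- integrality
  have h256i : IsIntegral ℤ (256 : M) := by
    have : IsIntegral ℤ ((256 : ℤ) : M) := isIntegral_algebraMap
    push_cast at this
    exact this
  have hw' : IsIntegral ℤ (256 * w : M) := h256i.mul hw
  have hwτ : IsIntegral ℤ (256 * τ w) := h256i.mul (map_isIntegral_int τ hw)
  have hIA : IsIntegral ℤ ((((2 * (X - 256) : ℤ) : M) / lamM ^ 3) ^ 2) := by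
    rw [hA]; exact (hw'.sub hwτ).pow 2
  have hIB : IsIntegral ℤ ((((2 * Y : ℤ) : M) * sM / lamM ^ 3) ^ 2) := by
    rw [hB]; exact (hw'.add hwτ).pow 2
  -- the squares are rational
  have hsqA : (((2 * (X - 256) : ℤ) : M) / lamM ^ 3) ^ 2 =
      ((-(4 * ((X : ℚ) - 256) ^ 2) / 27 : ℚ) : M) := by
    rw [div_pow, hl6]; push_cast; ring
  have hsqB : (((2 * Y : ℤ) : M) * sM / lamM ^ 3) ^ 2 = ((-(4 * (Y : ℚ) ^ 2 * d₀) / 27 : ℚ) : M) := by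
    rw [div_pow, mul_pow, hl6, hs2]; push_cast; ring
  rw [hsqA] at hIA
  rw [hsqB] at hIB
  obtain ⟨zA, hzA⟩ := exists_int_of_isIntegral_ratCast hIA
  obtain ⟨zB, hzB⟩ := exists_int_of_isIntegral_ratCast hIB
  have h27A : (27 : ℤ) ∣ 4 * (X - 256) ^ 2 * 1 := by
    refine ⟨-zA, ?_⟩
    have : ((27 * zA : ℤ) : ℚ) = ((-(4 * (X - 256) ^ 2) : ℤ) : ℚ) := by
      push_cast; rw [hzA]; ring
    have := (Int.cast_injective (α := ℚ)) this
    linarith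
  have h27B : (27 : ℤ) ∣ 4 * Y ^ 2 * d₀ := by
    refine ⟨-zB, ?_⟩
    have : ((27 * zB : ℤ) : ℚ) = ((-(4 * Y ^ 2 * d₀) : ℤ) : ℚ) := by
      push_cast; rw [hzB]; ring
    have := (Int.cast_injective (α := ℚ)) this
    linarith
  have h9A : (9 : ℤ) ∣ X - 256 := nine_dvd_of_twentyseven_dvd (m := 1) (by norm_num) h27A
  refine ⟨a, b, hunit, ?_, fun h3 => ?_, fun h3 => ?_⟩
  · -- `X ≡ 256 ≡ 4 (mod 9)`
    show (unitPow8 d a b).re % 9 = 4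
    rw [← hX]; omega
  · -- `3 ∣ d`: `3 ∤ d₀`, so `27 ∣ 4Y²d₀` gives `9 ∣ Y`
    have h3d₀ : ¬ (3 : ℤ) ∣ (d₀ : ℤ) := by
      have := not_three_dvd_mirrorRadicand hd h3
      rw [← hd₀] at this
      exact_mod_cast this
    exact nine_dvd_of_twentyseven_dvd h3d₀ h27B
  · -- `3 ∤ d`: `d₀ = 3d₁` with `3 ∤ d₁`, so `9 ∣ 4Y²d₁` gives `3 ∣ Y`
    obtain ⟨d₁, hd₁⟩ := three_dvd_mirrorRadicand h3
    have h3d₁ : ¬ (3 : ℤ) ∣ (d₁ : ℤ) := by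
      have := not_three_dvd_of_mirrorRadicand_eq hd hd₁
      exact_mod_cast this
    have h9 : (9 : ℤ) ∣ 4 * Y ^ 2 * d₁ := by
      have e : (3 : ℤ) * (4 * Y ^ 2 * d₁) = 4 * Y ^ 2 * (d₀ : ℤ) := by
        rw [hd₀, hd₁]; push_cast; ring
      have h27 : (3 : ℤ) * 9 ∣ 3 * (4 * Y ^ 2 * d₁) := by rw [e]; norm_num; exact h27B
      exact (mul_dvd_mul_iff_left (by norm_num)).mp h27
    exact three_dvd_of_nine_dvd h3d₁ h9

end ScholzHecke

end Literature.NumberTheory.QuadraticFields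

end
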